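import Literature.NumberTheory.Automorphic.CuspFormWhittakerSummable
import Literature.NumberTheory.Automorphic.MirabolicAveraging
import Literature.MeasureTheory.Group.CoveringWeightsBochner
import HarnessLib

/-!
# Inserting the Fourier–Whittaker expansion into the `GL_{m+1} × GL_m` integral:
`∫_G W_Φ(diag(x,1)) Θ(x) β_{N_m(K)}(x) dx = ∫_G Φ(diag(x,1)) Θ(x) β_{GL_m(K)}(x) dx`
(Cogdell (2004), §2.2, proof of Thm. 2.1: "since `φ` is left invariant under … we may unfold")

Topic `NumberTheory/Automorphic`; namespace `Literature.NumberTheory.Automorphic`. Proof file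
(theorems only), a brick of the inline decomposition of
`MoeglinWaldspurger1989_partialPairL_entire_of_rank_ne` along the road of
Jacquet–Piatetski-Shapiro–Shalika (Cogdell (2004), Thm. 2.1). The third step of the unfolding of
`I(s; φ, φ') = ∫_{GL_m(K)\GL_m(𝔸)} φ(diag(h,1)) φ'(h) |det h|^{s-1/2} dh` for `n = m + 1`: with the integral
written on the group against a `GL_m(K)`-covering weight `β` (`JPSSGlobalIntegralQuotientUnfolding`),
the Fourier–Whittaker expansion of the cusp form `Φ` on `GL_{m+1}` along the corner,

  `Φ(diag(x,1)) = Σ_{γ ∈ N_m(K)\GL_m(K)} W_Φ(diag(γ_𝔸 x, 1))`   (the tree's theorem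
  `hasSum_whittakerDepth_zero_of_summable` with `IsCuspFormGL.summable_norm_whittakerDepth_glCorner`,
  i.e. `Shalika1974_fourierExpansion_cuspForm_holds`, `W_Φ = whittakerDepth 0 Φ`),

is inserted and the sum over `N_m(K)\GL_m(K)` is unfolded against the covering weights
(`integral_wt_smul_eq_integral_wt_smul_tsum`, `CoveringWeightsBochner`, read from right to left):

* `existsUnique_rightCoset_rep` — the representatives `γ.out` (`γ ∈ N_m(K)\GL_m(K)`, Mathlib's
  `Quotient.out` of the right cosets) mapped into `GL_m(𝔸_K)` represent `N_m(K)_𝔸 \ GL_m(K)_𝔸`;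
* `integral_whittakerDepth_glCorner_mul_eq` (**main**) — for `0 < m`, a Haar measure `ν` on
  `GL_m(𝔸_K)`, a cusp form `Φ` on `GL_{m+1}(𝔸_K)` (`IsCuspFormGL`), a Borel left
  `GL_m(K)`-invariant factor `Θ` (in the application `Θ = Φ'(x) |det x|^{s-1/2}`), a `GL_m(K)`-covering
  weight `β` and an `N_m(K)`-covering weight `β'` on `GL_m(𝔸_K)`: if
  `∫ ‖W_Φ(diag(x,1)) Θ(x)‖ β'(x) dν < ∞` then

    `∫ W_Φ(diag(x,1)) Θ(x) β'(x) dν(x) = ∫ Φ(diag(x,1)) Θ(x) β(x) dν(x)`.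

The finiteness hypothesis is the absolute convergence of the unfolded integral for `Re s ≫ 0`
(Cogdell (2004), §2.3), supplied separately.

## References

* J. W. Cogdell, *Analytic theory of L-functions for GL_n*, in *An Introduction to the Langlands
  Program* (2004), §2.2 (PDF pp. 181–182) [CogdellAnalyticTheory2004].
* J. A. Shalika, *The multiplicity one theorem for GL_n*, Ann. of Math. 100 (1974), §5.
-/

noncomputable section

open MeasureTheory Measure NumberField IsDedekindDomain Matrix Set Filter Topology
open Literature.MeasureTheory.Group
open scoped MatrixGroups ENNReal NNReal

namespace Literature.NumberTheory.Automorphic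

section Unfold

variable {m : ℕ} {K : Type} [Field K] [NumberField K]

local notation "𝔸" => AdeleRing (𝓞 K) K

/-- **Representatives of `N_m(K)\GL_m(K)` inside `GL_m(𝔸_K)`.** For `g ∈ GL_m(K)_𝔸` there is exactly one
right coset `γ ∈ N_m(K)\GL_m(K)` with `g (γ.out_𝔸)⁻¹ ∈ N_m(K)_𝔸` (the hypothesis `hs` of
`integral_wt_smul_eq_integral_wt_smul_tsum` for `s γ = (γ.out)_𝔸`). [folklore] -/
theorem existsUnique_rightCoset_rep (g : GL (Fin m) 𝔸)
    (hg : g ∈ ratPoints (⊤ : Subgroup (GL (Fin m) K))) :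
    ∃! γ : Quotient (QuotientGroup.rightRel (upperUnitriangular (Fin m) K)),
      g * (ratGL K γ.out)⁻¹ ∈ ratPoints (tailUnipotent m K 0) := by
  obtain ⟨g₀, -, rfl⟩ := (mem_ratPoints_iff _ _).1 hg
  have key : ∀ γ : Quotient (QuotientGroup.rightRel (upperUnitriangular (Fin m) K)),
      ratGL K g₀ * (ratGL K γ.out)⁻¹ ∈ ratPoints (tailUnipotent m K 0) ↔
        γ = Quotient.mk (QuotientGroup.rightRel (upperUnitriangular (Fin m) K)) g₀ := by
    intro γ
    rw [← map_inv (Matrix.GeneralLinearGroup.map (algebraMap K 𝔸)) γ.out, ← map_mul, mem_ratPoints_iff,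
      tailUnipotent_zero]
    constructor
    · rintro ⟨u, hu, hue⟩
      have hu' : g₀ * γ.out⁻¹ = u := (generalLinearGroup_map_algebraMap_injective hue).symm
      rw [← hu'] at hu
      -- `g₀ γ.out⁻¹ ∈ N` means `rightRel γ.out g₀`, i.e. `⟦γ.out⟧ = ⟦g₀⟧`
      have h1 : Quotient.mk (QuotientGroup.rightRel (upperUnitriangular (Fin m) K)) γ.out =
          Quotient.mk (QuotientGroup.rightRel (upperUnitriangular (Fin m) K)) g₀ :=
        Quotient.sound (QuotientGroup.rightRel_apply.2 hu)
      rw [← h1, Quotient.out_eq]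
    · rintro rfl
      refine ⟨g₀ * (Quotient.mk (QuotientGroup.rightRel (upperUnitriangular (Fin m) K)) g₀).out⁻¹, ?_, rfl⟩
      have h1 := Quotient.mk_out (s := QuotientGroup.rightRel (upperUnitriangular (Fin m) K)) g₀
      exact QuotientGroup.rightRel_apply.1 h1
  refine ⟨Quotient.mk _ g₀, (key _).2 rfl, fun γ hγ => (key γ).1 hγ⟩

variable [MeasurableSpace (GL (Fin (m + 1)) (AdeleRing (𝓞 K) K))] [BorelSpace (GL (Fin (m + 1)) (AdeleRing (𝓞 K) K))]
variable [MeasurableSpace (GL (Fin m) (AdeleRing (𝓞 K) K))] [BorelSpace (GL (Fin m) (AdeleRing (𝓞 K) K))]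

-- `AutomorphyDatum.gl` lives over the coefficient algebra `mixedSpace K`, whose `Fintype` instances need
-- classical decidability (as in `CuspFormFourierExpansionGLn`).
open scoped Classical in
/-- **Inserting the Fourier–Whittaker expansion and unfolding `GL_m(K) ⊇ N_m(K)`** (Cogdell (2004),
§2.2). Let `0 < m`, `ν` a Haar measure on `GL_m(𝔸_K)`, `Φ` a cusp form on `GL_{m+1}(𝔸_K)`
(`IsCuspFormGL`, for the maximal compact level structure), `Θ : GL_m(𝔸_K) → ℂ` Borel and left
`GL_m(K)`-invariant, `β` a Borel `GL_m(K)`-covering weight and `β'` a Borel `N_m(K)`-covering weight on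
`GL_m(𝔸_K)` (covering sums `1`). If `∫ ‖W_Φ(diag(x,1)) Θ(x)‖ β'(x) dν < ∞` (`W_Φ = whittakerDepth 0 Φ`), then

  `∫ W_Φ(diag(x,1)) Θ(x) β'(x) dν(x) = ∫ Φ(diag(x,1)) Θ(x) β(x) dν(x)`.

Proof: `F(x) = W_Φ(diag(x,1)) Θ(x)` is left `N_m(K)`-invariant (`whittakerDepth_zero_glCorner_ratGL_mul`);
unfold `∫ F β' = ∫ β Σ_{γ ∈ N\GL_m(K)} F(γ_𝔸 ·)` (`integral_wt_smul_eq_integral_wt_smul_tsum` with the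
representatives `γ.out`), and `Σ_γ F(γ_𝔸 x) = Θ(x) Σ_γ W_Φ(diag(γ_𝔸,1) diag(x,1)) = Θ(x) Φ(diag(x,1))` by the
Fourier–Whittaker expansion of `Φ` at `diag(x,1)` (`hasSum_whittakerDepth_zero_of_summable`,
`IsCuspFormGL.summable_norm_whittakerDepth_glCorner`). [cite: CogdellAnalyticTheory2004, §2.2 (PDF p. 182)] -/
theorem integral_whittakerDepth_glCorner_mul_eq
    (ν : Measure (GL (Fin m) 𝔸)) [IsHaarMeasure ν]
    {Φ : GL (Fin (m + 1)) 𝔸 → ℂ} (hΦ : IsCuspFormGL (m + 1) K (isCompact_glFiniteIntegralLevel_holds (m + 1) K) Φ)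
    {Θ : GL (Fin m) 𝔸 → ℂ} (hΘm : Measurable Θ)
    (hΘK : ∀ (γ₀ : GL (Fin m) K) (x : GL (Fin m) 𝔸), Θ (ratGL K γ₀ * x) = Θ x)
    {β β' : GL (Fin m) 𝔸 → ℝ≥0∞} (hβm : Measurable β)
    (hβ : ∀ x, coveringSum ↥(ratPoints (⊤ : Subgroup (GL (Fin m) K))) β x = 1)
    (hβ'm : Measurable β') (hβ' : ∀ x, coveringSum ↥(ratPoints (tailUnipotent m K 0)) β' x = 1)
    (hint : ∫⁻ x, ‖whittakerDepth 0 Φ (glCorner 𝔸 (Nat.le_succ m) x) * Θ x‖ₑ * β' x ∂ν < ∞) :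
    ∫ x, whittakerDepth 0 Φ (glCorner 𝔸 (Nat.le_succ m) x) * Θ x * ((β' x).toReal : ℂ) ∂ν =
      ∫ x, Φ (glCorner 𝔸 (Nat.le_succ m) x) * Θ x * ((β x).toReal : ℂ) ∂ν := by
  borelize (AdeleRing (𝓞 K) K)
  -- instances
  haveI : T2Space (GL (Fin m) 𝔸) := t2Space_gl m K
  haveI : SecondCountableTopology (GL (Fin m) 𝔸) := secondCountableTopology_generalLinearGroup_adeleRing K (Fin m)
  haveI : MeasurableMul₂ (GL (Fin m) 𝔸) := inferInstance
  haveI : Countable K := NumberField.countable' (K := K)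
  haveI : Countable (Matrix (Fin m) (Fin m) K) := inferInstanceAs (Countable (Fin m → Fin m → K))
  haveI : Countable (GL (Fin m) K) :=
    Function.Injective.countable (f := fun g : GL (Fin m) K => (g : Matrix (Fin m) (Fin m) K)) fun _ _ h => Units.ext h
  haveI : Countable ↥(ratPoints (⊤ : Subgroup (GL (Fin m) K))) :=
    Countable.of_equiv _ (ratPointsEquiv (⊤ : Subgroup (GL (Fin m) K))).toEquiv
  -- data of the cusp form
  have hΦc : Continuous Φ := hΦ.1.continuous_gl
  have hΦK : ∀ (δ : GL (Fin (m + 1)) K) (y : GL (Fin (m + 1)) 𝔸), Φ (ratGL K δ * y) = Φ y :=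
    fun δ y => hΦ.1.leftInvariant _ (show _ ∈ rationalPointsGL (m + 1) K from ⟨δ, rfl⟩) y
  have hWc : Continuous (whittakerDepth 0 Φ) := continuous_whittakerDepth hΦc 0
  have hιc : Continuous (glCorner 𝔸 (Nat.le_succ m)) := continuous_glCorner (Nat.le_succ m)
  -- the integrand `F = W(ι ·) Θ`
  set F : GL (Fin m) 𝔸 → ℂ := fun x => whittakerDepth 0 Φ (glCorner 𝔸 (Nat.le_succ m) x) * Θ x with hF
  have hFm : Measurable F := (hWc.comp hιc).measurable.mul hΘm
  have hFinv : ∀ γ ∈ ratPoints (tailUnipotent m K 0), ∀ x : GL (Fin m) 𝔸, F (γ • x) = F x := by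
    intro γ hγ x
    obtain ⟨u, hu, rfl⟩ := (mem_ratPoints_iff _ _).1 hγ
    rw [tailUnipotent_zero] at hu
    simp only [hF, smul_eq_mul, map_mul]
    rw [hΘK, whittakerDepth_zero_glCorner_ratGL_mul hΦK (Nat.succ_pos m) (Nat.le_succ m) hu]
  -- representatives
  set srep : Quotient (QuotientGroup.rightRel (upperUnitriangular (Fin m) K)) → GL (Fin m) 𝔸 :=
    fun γ => ratGL K γ.out with hsrep
  have hsΓ : ∀ γ, srep γ ∈ ratPoints (⊤ : Subgroup (GL (Fin m) K)) :=
    fun γ => (mem_ratPoints_iff _ _).2 ⟨γ.out, Subgroup.mem_top _, rfl⟩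
  have hs : ∀ g ∈ ratPoints (⊤ : Subgroup (GL (Fin m) K)), ∃! γ, g * (srep γ)⁻¹ ∈ ratPoints (tailUnipotent m K 0) :=
    fun g hg => existsUnique_rightCoset_rep g hg
  -- unfold
  have hle : ratPoints (tailUnipotent m K 0) ≤ ratPoints (⊤ : Subgroup (GL (Fin m) K)) := ratPoints_mono le_top
  have key := integral_wt_smul_eq_integral_wt_smul_tsum ν (ratPoints (⊤ : Subgroup (GL (Fin m) K)))
    (ratPoints (tailUnipotent m K 0)) hle hFm.stronglyMeasurable hFinv hβ'm hβ' hβm hβ hsΓ hs hint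
  -- the Fourier–Whittaker expansion along the corner
  have hsum : ∀ x : GL (Fin m) 𝔸, ∑' γ, F (srep γ • x) = Φ (glCorner 𝔸 (Nat.le_succ m) x) * Θ x := by
    intro x
    have hterm : ∀ γ : Quotient (QuotientGroup.rightRel (upperUnitriangular (Fin m) K)),
        F (srep γ • x) = whittakerDepth 0 Φ (glCorner 𝔸 (Nat.le_succ m) (ratGL K γ.out) *
          glCorner 𝔸 (Nat.le_succ m) x) * Θ x := by
      intro γ
      simp only [hF, hsrep, smul_eq_mul, map_mul, hΘK]
    simp_rw [hterm]
    rw [tsum_mul_right]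
    congr 1
    have hS := hΦ.summable_norm_whittakerDepth_glCorner (glCorner 𝔸 (Nat.le_succ m) x)
    have hFE := hasSum_whittakerDepth_zero_of_summable (n := m + 1) hΦc hΦK hΦ.2 (by omega)
      (glCorner 𝔸 (Nat.le_succ m) x) hS
    exact hFE.tsum_eq
  -- assemble
  have h1 : ∀ x : GL (Fin m) 𝔸, wt β' x • F x =
      whittakerDepth 0 Φ (glCorner 𝔸 (Nat.le_succ m) x) * Θ x * ((β' x).toReal : ℂ) := fun x => by
    rw [wt, Complex.real_smul, hF]; ring
  have h2 : ∀ x : GL (Fin m) 𝔸, wt β x • (∑' γ, F (srep γ • x)) =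
      Φ (glCorner 𝔸 (Nat.le_succ m) x) * Θ x * ((β x).toReal : ℂ) := fun x => by
    rw [hsum x, wt, Complex.real_smul]; ring
  simp_rw [h1, h2] at key
  exact key

end Unfold

end Literature.NumberTheory.Automorphic
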